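import Summits.HodgeConjecture.HodgeConjecture.Theorems.F0LD1MeetsOfRealises
import Summits.HodgeConjecture.HodgeConjecture.Theorems.F0LD2ThetaFinComponent
import Summits.HodgeConjecture.HodgeConjecture.Theorems.F0LD2ArchAdmissibleAssembly
import Literature.NumberTheory.Rogawski1990.CurveThetaHodgeTypeNecessity
import Literature.NumberTheory.Rogawski1990.CurveCohomologicalSpectrum
import Literature.NumberTheory.Automorphic.Liu2021.ThetaLiftFromLineIrreducible
import Literature.NumberTheory.Automorphic.HilbertRepSpectrumProofs
import HarnessLib

-- As in the lineage: statements over the theta-kernel datum elaborate to very large types; elaborate sequentially.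
set_option Elab.async false

/-!
# Crux `HLiu418`, line LD1 (θ-road) — ORGAN (R) `ThetaRealisation₂` (= LD2 organ A₂) CLOSED MODULO THREE LETTERS, NONE OF THEM A MULTIPLICITY STATEMENT:
# (A₂-P) non-orthogonality [Liu2021, Thm. B.4 (1)] + (B6) realisation [Liu2021, Cor. B.6 (1) 2nd clause = Wu2013 Thm. 5.1] + (I′) irreducibility [Wu2013 Thm. 5.3]

Cell hodgecm-mathlib (D-0151), FLOOR 0; crux item `HLiu418` = stmt-HodgeConjecture-24832 (route `HCCMUnconditional`); half-A line LD1 (`stub_S1_facts` = #73,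
[Liu2021, Prop. D.4 (1)] «≤ 1») of socket 27458 `Cruxes/HLiu418/Lines/F0_AlbCm.lean`, leaf `Lines/F0_P6LD_StubS1FactsThetaRoad.lean` organ (R) :298 = LD2 organ
A₂ (token for token).  Seat LD1-p01 (g0); LEAD ruling «LD-R3′» PATH Y (F0P6-plan (g3), 2026-09-02T05:11:42Z): «#73 is paid by the θ-road, not by the
mult-one letter … (R) := `thetaRealisation₂_of_B6 stub_letter_A₂P stub_letter_B6 stub_thetaSpaceIrreducible`».  THIS FILE = ★
`F0LD2ThetaRealisationOfLetters.thetaRealisation₂_of_letters (hAP) (hM1) (hIrr)` (LA1-p01 (g2), p849272) with the hypothesis `hM1 :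
Rogawski1990.curveMultiplicityLeOne` (Arthur-multiplicity-formula grade, and ALONE sufficient for #73) STRUCK and replaced by `hB6` = the statement-only row
`Liu2021.ThetaLiftFromLineRealises` closed over the CM curve frames (same quantifier prefix as `hIrr`): «if `pr_P` does not kill every `(a′, ξ)`-theta class
then the carrier of `P` lies in their closed span» — print: [Liu2021, Cor. B.6 (1)] «`V_π = Θ^V_{(μ⁻¹,ν⁻¹),−W}(Θ^W_{(μ,ν),V}(V_π))`» = [Wu2013, Thm. 5.1]
(Rallis' inner product formula in operator form: the doubling integral reproduces the vector).  THEOREMS ONLY (no `def`, no instance, no notation, no named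
fact, no `sorry`); `--supports stmt-HodgeConjecture-24832`.  HC_CM is proved only modulo the 7 printed citations (2 remaining: hLiu418 =
stmt-HodgeConjecture-24832, h413 = stmt-HodgeConjecture-24833) until rung 0 closes; this file discharges nothing printed — it is the kernel glue
`(A₂-P) → (B6) → (I′) → (R)`, each letter taken as a HYPOTHESIS, and it shows that the θ-road books NO multiplicity statement: in print, multiplicity one of
the theta class is itself DERIVED from B.6 (1) ([Liu2021, Cor. B.6 (3)], used by Prop. 4.13 Case 1), so `m ≤ 1` for the holomorphic θ-class (#73) becomes a
COROLLARY of the road.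

THE THREE HYPOTHESES (BY VALUE — bodies verbatim — so the leaf may feed either letter constants, by `delta`, or its own letter stubs):
* `hAP` = the body of the (A₂-P) letter `Liu2021.curveHolTheta_nonOrthogonal₂` (LD2-p02 (g0) draft 975b4095b9e11d64): [Liu2021, proof of Prop. D.4 (1)
  p. 131 L8–21 via Thm. B.4 (1)] — a `(1,0)`-type `P` with θ-type finite component at the label `λ` has, for SOME line `⟨a′⟩`, a theta class whose projection
  to `P` is non-zero (= ★ p849272's `hAP`, byte-identical);
* `hB6` = `∀` curve frame, `∀ a′ ξ`, the body of `Liu2021.ThetaLiftFromLineRealises L 2 H e₁ dV hdV hdV0 ιA μ lam hlam a′ ξ` ([Liu2021, Cor. B.6 (1) 2nd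
  clause] = [Wu2013, Thm. 5.1]);
* `hIrr` = the body of organ (I′) `ThetaSpaceIrreducible₂` (= ★ letter-predicate `Liu2021.ThetaLiftFromLineIrreducible` closed over the curve frames;
  [Liu2021, Cor. B.6 (1) 1st clause] = [Wu2013, Thm. 5.3]) (= ★ p849272's `hIrr`, byte-identical).

THE PROOF (p849272's, one step shorter): the pinned transport `ιA` EXISTS under the scaled frame (★ `F0LD2ArchAdmissibleAssembly.exists_adelicFrameTransport_smul`);
`[U(H)]` is compact (★ `exists_infinitePlace_ne` + ★ `anisotropic_of_formCongr_smul_eq_of_posDef` + ★ `compactSpace_adelicGroupData_automorphicQuotient`); `hAP`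
gives the line `a′` and the non-orthogonality; the junction WITHOUT multiplicity one ★ (R-J′) `F0LD1MeetsOfRealises.meetsThetaLiftFromLine_of_realises`
(LD1-p01 (g0)) turns it into `MeetsThetaLiftFromLine … a′ ιA` with `hIrr` and `hB6` at `a′`.

HONEST SCOPE.  Nothing deep is proved here: the pole ⟹ theta step is the letter `hAP`, the realisation identity is the letter `hB6`, the irreducibility of the
theta span is the letter `hIrr`.  Junk: each hypothesis is consumed (no vacuous body; `hsig` feeds `hAP`∕`hB6`∕`hIrr` verbatim).

## References
* [Liu2021] Y. Liu, Camb. J. Math. 9 (2021) = arXiv:2102.11518: App. D proof of Prop. D.4 (1) (p. 130 L34 – p. 131 L21); App. B Thm. B.4 (1) (p. 98),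
  Cor. B.6 (1), (3) and their proofs (p. 99); proof of Prop. 4.13 Case 1 (p. 48).
* [Wu2013] C. Wu, *Irreducibility of theta lifting for unitary groups*, J. Number Theory 133 (2013), Thm. 5.1, Thm. 5.3.
* [Rallis1984] S. Rallis, *On the Howe duality conjecture*, Compositio Math. 51 (1984), §1.  [DeitmarEchterhoff2014] Cor. 6.1.9.
-/

set_option autoImplicit false
-- the mandated namespace has the single-problem summit's repeated segment (`HodgeConjecture.HodgeConjecture`)
set_option linter.dupNamespace false

noncomputable section

open NumberField NumberField.InfinitePlace MeasureTheory IsDedekindDomain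
open scoped Matrix ComplexOrder ENNReal Classical

namespace Summit.HodgeConjecture.HodgeConjecture.Cruxes.HLiu418.F0LD1ThetaRealisationOfB6


open Literature.RepresentationTheory.CompactGroups
open _root_.MeasureTheory
open Literature.NumberTheory.Automorphic Literature.NumberTheory.Automorphic.UnitaryGroup
open Literature.NumberTheory.Automorphic.UnitaryGroup.CotangentForms
open Literature.NumberTheory.Automorphic.UnitaryCurveForms
open Literature.NumberTheory.Automorphic.IdeleClassGroup
open Literature.NumberTheory.Automorphic.Liu2021
open Literature.NumberTheory.Automorphic.Liu2021.Def411WeilCarriers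
open Literature.NumberTheory.Automorphic.Liu2021.Def411WeilCarriersDoubling
open Literature.NumberTheory.GaloisRepresentations
open Literature.NumberTheory.GelbartRogawski1991 Literature.NumberTheory.GelbartRogawski1991.UnitaryDualPair
open Literature.NumberTheory.Weil1964
open Literature.RepresentationTheory.Liu2021 Literature.RepresentationTheory.HarrisKudlaSweet1996
open Literature.NumberTheory.Rogawski1990

set_option maxHeartbeats 1600000 in
-- (three letter bodies and the organ body are large binder telescopes; the proof is four named steps)
/-- **ORGAN (R) = A₂ `ThetaRealisation₂` FROM THREE LETTERS, NONE OF THEM A MULTIPLICITY STATEMENT** — [Liu2021, proof of Prop. 4.13 Case 1 ∕ Cor. B.6]: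
a discrete `P` of the CM unitary curve `U(H)`, `H¹`-holomorphic at `ι` with θ-type finite component `σ ↪ ω(λ, ε_a, χ)_f`, MEETS the global theta lift from
some hermitian line `⟨a′⟩` at the splitting `λ`, along the pinned adelic transport `ιA` (which exists).  Hypotheses BY VALUE (LEAD ruling «LD-R3′» PATH Y, 2026-09-02T05:11:42Z): `hAP` = (A₂-P)
`curveHolTheta_nonOrthogonal₂` body ([Liu2021, Thm. B.4 (1)]: non-orthogonality), `hB6` = the realisation row `Liu2021.ThetaLiftFromLineRealises` closed over
the curve frames ([Liu2021, Cor. B.6 (1) second clause] = [Wu2013, Thm. 5.1]), `hIrr` = (I′) `ThetaSpaceIrreducible₂` body ([Liu2021, Cor. B.6 (1) first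
clause] = [Wu2013, Thm. 5.3]); conclusion = the LD1 organ (R) ∕ LD2 organ A₂ text VERBATIM (= ★ `F0LD2ThetaRealisationOfLetters.thetaRealisation₂_of_letters`
with `hM1 : curveMultiplicityLeOne` REPLACED by `hB6`).  Proof: ★ `exists_adelicFrameTransport_smul`, compactness of `[U(H)]`, `hAP`, (R-J′)
`meetsThetaLiftFromLine_of_realises`.
[cite: Liu2021, App. B Cor. B.6 (1), (3) and proofs (p. 99); proof of Prop. 4.13 Case 1 (p. 48); App. D proof of Prop. D.4 (1) (p. 131 L8–21)]
[cite: Wu2013, Thm. 5.1, Thm. 5.3] -/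
theorem thetaRealisation₂_of_B6
    (hAP :
      ∀ (L : Type) [Field L] [NumberField L] [IsCMField L] (ι : L →+* ℂ) (H : Matrix (Fin 2) (Fin 2) L)
        (dV : Fin 2 → L) (hdV : ∀ i, IsCMField.complexConj L (dV i) = dV i) (hdV0 : ∀ i, dV i ≠ 0)
        (t : L) (ht : t ≠ 0) (g : GL (Fin 2) L)
        (hg : formCongr ((IsCMField.complexConj L : L ≃ₐ[↥(maximalRealSubfield L)] L) : L →+* L) g (t • H) = Matrix.diagonal dV),
        (∃ T : GL (Fin 2) ℂ, formCongr (starRingEnd ℂ) T ((Matrix.diagonal dV).map ι) = Matrix.diagonal ![(1 : ℂ), -1]) →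
        (∀ τ' : L →+* ℂ, InfinitePlace.mk τ' ≠ InfinitePlace.mk ι → ((Matrix.diagonal dV).map τ').PosDef) →
        4 ≤ Module.finrank ℚ L →
        ∀ (𝔣 : ConeFrame L H (cmPlace L ι))
          (μ : Measure (adelicGroupData (↥(maximalRealSubfield L)) L (IsCMField.complexConj L) 2 H).automorphicQuotient)
          [(adelicGroupData (↥(maximalRealSubfield L)) L (IsCMField.complexConj L) 2 H).IsAutomorphicMeasure μ]
          {n' : ℕ} (e₁ : Fin 2 × Fin 1 ≃ Fin n')
          (lam : Literature.NumberTheory.Automorphic.IdeleClassGroup L →ₜ* Circle) (hlam : IsConjugateSymplectic L lam), HasWeight L lam 1 →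
        ∀ (a : (↥(maximalRealSubfield L))ˣ) (χ : Chi (↥(maximalRealSubfield L)) L (IsCMField.complexConj L))
          (W : Type) [AddCommGroup W] [Module ℂ W]
          (σ : Representation ℂ (finAdelic (↥(maximalRealSubfield L)) L (IsCMField.complexConj L) 2 H) W),
          σ.IsIrreducible → σ.IsSmooth →
        ∀ j : σ.IntertwiningMap
            ((rhoVAtLine (↥(maximalRealSubfield L)) L (IsCMField.complexConj L) 2 e₁ (Matrix.diagonal dV)
                (complexConj_imagUnit L) (imagUnit_ne_zero L) (imagUnit_mul_self L) (realDiagonal_isSymm L dV hdV)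
                (isUnit_det_realDiagonal L dV hdV hdV0) (realDiagonal_map L dV hdV).symm
                (fun a => isCompatible_chiSplittingLine L e₁ dV hdV hdV0 (toHeckeCharacter L lam)
                  (isUnitary_toHeckeCharacter L lam) ((isOscillatorChar_toHeckeCharacter_iff lam).mpr hlam)
                  (TW (↥(maximalRealSubfield L)) a) (isSymm_TW (↥(maximalRealSubfield L)) a)
                  (isUnit_det_TW (↥(maximalRealSubfield L)) a) (JW (↥(maximalRealSubfield L)) L a)
                  (JW_eq (↥(maximalRealSubfield L)) L a)) a χ).comp
              (finAdelicCongr (↥(maximalRealSubfield L)) L (IsCMField.complexConj L) g ht hg).symm.toMonoidHom),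
          Function.Injective j →
        ∀ (ιA : (adelicGroupData (↥(maximalRealSubfield L)) L (IsCMField.complexConj L) 2 H).Adelic →*
            ↥(UnitaryGroup.adelic (↥(maximalRealSubfield L)) L (IsCMField.complexConj L) 2 (Matrix.diagonal dV))),
          (∀ k, ((ιA k : ↥(UnitaryGroup.adelic (↥(maximalRealSubfield L)) L (IsCMField.complexConj L) 2 (Matrix.diagonal dV))) :
                GL (Fin 2) (AdeleRing (𝓞 L) L)) =
              (toAdeleGL L g)⁻¹ * adelicVal (↥(maximalRealSubfield L)) L (IsCMField.complexConj L) 2 H k * toAdeleGL L g) →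
        ∀ [CompactSpace (↥(UnitaryGroup.adelic (↥(maximalRealSubfield L)) L (IsCMField.complexConj L) 2 (Matrix.diagonal dV)) ⧸
            (UnitaryGroup.toAdelic (↥(maximalRealSubfield L)) L (IsCMField.complexConj L) 2 (Matrix.diagonal dV)).range)]
          [CompactSpace (adelicGroupData (↥(maximalRealSubfield L)) L (IsCMField.complexConj L) 2 H).automorphicQuotient],
        ∀ P : DiscreteAutomorphicRep (adelicGroupData (↥(maximalRealSubfield L)) L (IsCMField.complexConj L) 2 H) μ,
          P.IsHolCotangentAt₂ (IsCMField.complexConj_ne_one L) (UnitaryGroup.complexConj_smul_infinitePlace L) (cmPlace L ι) 𝔣 →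
          P.HasFinComponent σ →
          ∃ a' : (↥(maximalRealSubfield L))ˣ,
            letI : MeasurableSpace (↥(UnitaryGroup.adelic (↥(maximalRealSubfield L)) L (IsCMField.complexConj L) 1 (JW (↥(maximalRealSubfield L)) L a')) ⧸
                (UnitaryGroup.toAdelic (↥(maximalRealSubfield L)) L (IsCMField.complexConj L) 1 (JW (↥(maximalRealSubfield L)) L a')).range) := borel _
            haveI := normal_range_toAdelic_JW L a'
            ∃ (hρ : HasThetaMajorants fun
                (p : ↥(UnitaryGroup.adelic (↥(maximalRealSubfield L)) L (IsCMField.complexConj L) 2 (Matrix.diagonal dV)) ×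
                  ↥(UnitaryGroup.adelic (↥(maximalRealSubfield L)) L (IsCMField.complexConj L) 1 (JW (↥(maximalRealSubfield L)) L a')))
                  (Φ : piSchwartzBruhat (↥(maximalRealSubfield L)) (Fin n')) =>
                  pairRep (↥(maximalRealSubfield L)) L (IsCMField.complexConj L) 2 1 e₁ (Matrix.diagonal dV) (JW (↥(maximalRealSubfield L)) L a')
                    (chiSplittingLine L e₁ dV hdV hdV0 (toHeckeCharacter L lam) (isUnitary_toHeckeCharacter L lam)
                      ((isOscillatorChar_toHeckeCharacter_iff lam).mpr hlam) (TW (↥(maximalRealSubfield L)) a')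
                      (isUnit_det_TW (↥(maximalRealSubfield L)) a') (JW (↥(maximalRealSubfield L)) L a') (JW_eq (↥(maximalRealSubfield L)) L a'))
                    p Φ)
              (μW : Measure (↥(UnitaryGroup.adelic (↥(maximalRealSubfield L)) L (IsCMField.complexConj L) 1 (JW (↥(maximalRealSubfield L)) L a')) ⧸
                (UnitaryGroup.toAdelic (↥(maximalRealSubfield L)) L (IsCMField.complexConj L) 1 (JW (↥(maximalRealSubfield L)) L a')).range))
              (_ : IsFiniteMeasure μW)
              (_ : SMulInvariantMeasure ↥(UnitaryGroup.adelic (↥(maximalRealSubfield L)) L (IsCMField.complexConj L) 1 (JW (↥(maximalRealSubfield L)) L a'))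
                (↥(UnitaryGroup.adelic (↥(maximalRealSubfield L)) L (IsCMField.complexConj L) 1 (JW (↥(maximalRealSubfield L)) L a')) ⧸
                  (UnitaryGroup.toAdelic (↥(maximalRealSubfield L)) L (IsCMField.complexConj L) 1 (JW (↥(maximalRealSubfield L)) L a')).range) μW)
              (f : C((↥(UnitaryGroup.adelic (↥(maximalRealSubfield L)) L (IsCMField.complexConj L) 1 (JW (↥(maximalRealSubfield L)) L a')) ⧸
                (UnitaryGroup.toAdelic (↥(maximalRealSubfield L)) L (IsCMField.complexConj L) 1 (JW (↥(maximalRealSubfield L)) L a')).range), ℂ))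
              (Φ : piSchwartzBruhat (↥(maximalRealSubfield L)) (Fin n'))
              (hθ : MemLp (toQuotFun (adelicGroupData (↥(maximalRealSubfield L)) L (IsCMField.complexConj L) 2 H) fun x =>
                (lineThetaKernelDatum L 2 e₁ dV hdV hdV0 lam hlam a' hρ).thetaLiftFun μW Φ f (ιA x)) 2 μ),
              P.space.toSubmodule.starProjection (MemLp.toLp _ hθ) ≠ 0)
    (hB6 :
      ∀ (L : Type) [Field L] [NumberField L] [IsCMField L] (ι : L →+* ℂ) (H : Matrix (Fin 2) (Fin 2) L)
          (dV : Fin 2 → L) (hdV : ∀ i, IsCMField.complexConj L (dV i) = dV i) (hdV0 : ∀ i, dV i ≠ 0)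
          (t : L) (ht : t ≠ 0) (g : GL (Fin 2) L)
          (_hg : formCongr ((IsCMField.complexConj L : L ≃ₐ[↥(maximalRealSubfield L)] L) : L →+* L) g (t • H) = Matrix.diagonal dV),
          (∃ T : GL (Fin 2) ℂ, formCongr (starRingEnd ℂ) T ((Matrix.diagonal dV).map ι) = Matrix.diagonal ![(1 : ℂ), -1]) →
          (∀ τ' : L →+* ℂ, InfinitePlace.mk τ' ≠ InfinitePlace.mk ι → ((Matrix.diagonal dV).map τ').PosDef) →
          4 ≤ Module.finrank ℚ L →
          ∀ (μ : Measure (adelicGroupData (↥(maximalRealSubfield L)) L (IsCMField.complexConj L) 2 H).automorphicQuotient)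
            [(adelicGroupData (↥(maximalRealSubfield L)) L (IsCMField.complexConj L) 2 H).IsAutomorphicMeasure μ]
            {n' : ℕ} (e₁ : Fin 2 × Fin 1 ≃ Fin n')
            (lam : Literature.NumberTheory.Automorphic.IdeleClassGroup L →ₜ* Circle) (hlam : IsConjugateSymplectic L lam), HasWeight L lam 1 →
          ∀ (ιA : (adelicGroupData (↥(maximalRealSubfield L)) L (IsCMField.complexConj L) 2 H).Adelic →*
              ↥(UnitaryGroup.adelic (↥(maximalRealSubfield L)) L (IsCMField.complexConj L) 2 (Matrix.diagonal dV))),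
            (∀ k, ((ιA k : ↥(UnitaryGroup.adelic (↥(maximalRealSubfield L)) L (IsCMField.complexConj L) 2 (Matrix.diagonal dV))) :
                  GL (Fin 2) (AdeleRing (𝓞 L) L)) =
                (toAdeleGL L g)⁻¹ * adelicVal (↥(maximalRealSubfield L)) L (IsCMField.complexConj L) 2 H k * toAdeleGL L g) →
          ∀ [CompactSpace (↥(UnitaryGroup.adelic (↥(maximalRealSubfield L)) L (IsCMField.complexConj L) 2 (Matrix.diagonal dV)) ⧸
              (UnitaryGroup.toAdelic (↥(maximalRealSubfield L)) L (IsCMField.complexConj L) 2 (Matrix.diagonal dV)).range)],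
          ∀ (a' : (↥(maximalRealSubfield L))ˣ)
            (ξ : haveI := normal_range_toAdelic_JW L a'
              PontryaginDual (↥(UnitaryGroup.adelic (↥(maximalRealSubfield L)) L (IsCMField.complexConj L) 1 (JW (↥(maximalRealSubfield L)) L a')) ⧸ (UnitaryGroup.toAdelic (↥(maximalRealSubfield L)) L (IsCMField.complexConj L) 1 (JW (↥(maximalRealSubfield L)) L a')).range)),
            letI : MeasurableSpace (↥(UnitaryGroup.adelic (↥(maximalRealSubfield L)) L (IsCMField.complexConj L) 1 (JW (↥(maximalRealSubfield L)) L a')) ⧸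
                (UnitaryGroup.toAdelic (↥(maximalRealSubfield L)) L (IsCMField.complexConj L) 1 (JW (↥(maximalRealSubfield L)) L a')).range) := borel _
            haveI := normal_range_toAdelic_JW L a'
            ∀ P : DiscreteAutomorphicRep (adelicGroupData (↥(maximalRealSubfield L)) L (IsCMField.complexConj L) 2 H) μ,
            (∃ (hρ : HasThetaMajorants fun
              (p : ↥(UnitaryGroup.adelic (↥(maximalRealSubfield L)) L (IsCMField.complexConj L) 2 (Matrix.diagonal dV)) × ↥(UnitaryGroup.adelic (↥(maximalRealSubfield L)) L (IsCMField.complexConj L) 1 (JW (↥(maximalRealSubfield L)) L a'))) (Φ : piSchwartzBruhat (↥(maximalRealSubfield L)) (Fin n')) =>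
                pairRep (↥(maximalRealSubfield L)) L (IsCMField.complexConj L) 2 1 e₁ (Matrix.diagonal dV) (JW (↥(maximalRealSubfield L)) L a')
                  (chiSplittingLine L e₁ dV hdV hdV0 (toHeckeCharacter L lam) (isUnitary_toHeckeCharacter L lam)
                    ((isOscillatorChar_toHeckeCharacter_iff lam).mpr hlam) (TW (↥(maximalRealSubfield L)) a')
                    (isUnit_det_TW (↥(maximalRealSubfield L)) a') (JW (↥(maximalRealSubfield L)) L a') (JW_eq (↥(maximalRealSubfield L)) L a'))
                  p Φ)
                (μW : Measure (↥(UnitaryGroup.adelic (↥(maximalRealSubfield L)) L (IsCMField.complexConj L) 1 (JW (↥(maximalRealSubfield L)) L a')) ⧸ (UnitaryGroup.toAdelic (↥(maximalRealSubfield L)) L (IsCMField.complexConj L) 1 (JW (↥(maximalRealSubfield L)) L a')).range)) (_ : IsFiniteMeasure μW)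
                (_ : SMulInvariantMeasure ↥(UnitaryGroup.adelic (↥(maximalRealSubfield L)) L (IsCMField.complexConj L) 1 (JW (↥(maximalRealSubfield L)) L a')) (↥(UnitaryGroup.adelic (↥(maximalRealSubfield L)) L (IsCMField.complexConj L) 1 (JW (↥(maximalRealSubfield L)) L a')) ⧸ (UnitaryGroup.toAdelic (↥(maximalRealSubfield L)) L (IsCMField.complexConj L) 1 (JW (↥(maximalRealSubfield L)) L a')).range) μW)
                (Ψ : piSchwartzBruhat (↥(maximalRealSubfield L)) (Fin n'))
                (hθ : MemLp (toQuotFun (adelicGroupData (↥(maximalRealSubfield L)) L (IsCMField.complexConj L) 2 H) fun x =>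
                  (lineThetaKernelDatum L 2 e₁ dV hdV hdV0 lam hlam a' hρ).thetaLiftFun μW Ψ (charCM ξ) (ιA x)) 2 μ),
                P.space.toSubmodule.starProjection (MemLp.toLp _ hθ) ≠ 0) →
            (P.space.toSubmodule : Set ((adelicGroupData (↥(maximalRealSubfield L)) L (IsCMField.complexConj L) 2 H).L2 μ)) ⊆ closure (Submodule.span ℂ
                {v : (adelicGroupData (↥(maximalRealSubfield L)) L (IsCMField.complexConj L) 2 H).L2 μ | ∃ (hρ : HasThetaMajorants fun
              (p : ↥(UnitaryGroup.adelic (↥(maximalRealSubfield L)) L (IsCMField.complexConj L) 2 (Matrix.diagonal dV)) × ↥(UnitaryGroup.adelic (↥(maximalRealSubfield L)) L (IsCMField.complexConj L) 1 (JW (↥(maximalRealSubfield L)) L a'))) (Φ : piSchwartzBruhat (↥(maximalRealSubfield L)) (Fin n')) =>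
                pairRep (↥(maximalRealSubfield L)) L (IsCMField.complexConj L) 2 1 e₁ (Matrix.diagonal dV) (JW (↥(maximalRealSubfield L)) L a')
                  (chiSplittingLine L e₁ dV hdV hdV0 (toHeckeCharacter L lam) (isUnitary_toHeckeCharacter L lam)
                    ((isOscillatorChar_toHeckeCharacter_iff lam).mpr hlam) (TW (↥(maximalRealSubfield L)) a')
                    (isUnit_det_TW (↥(maximalRealSubfield L)) a') (JW (↥(maximalRealSubfield L)) L a') (JW_eq (↥(maximalRealSubfield L)) L a'))
                  p Φ)
                (μW : Measure (↥(UnitaryGroup.adelic (↥(maximalRealSubfield L)) L (IsCMField.complexConj L) 1 (JW (↥(maximalRealSubfield L)) L a')) ⧸ (UnitaryGroup.toAdelic (↥(maximalRealSubfield L)) L (IsCMField.complexConj L) 1 (JW (↥(maximalRealSubfield L)) L a')).range)) (_ : IsFiniteMeasure μW)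
                (_ : SMulInvariantMeasure ↥(UnitaryGroup.adelic (↥(maximalRealSubfield L)) L (IsCMField.complexConj L) 1 (JW (↥(maximalRealSubfield L)) L a')) (↥(UnitaryGroup.adelic (↥(maximalRealSubfield L)) L (IsCMField.complexConj L) 1 (JW (↥(maximalRealSubfield L)) L a')) ⧸ (UnitaryGroup.toAdelic (↥(maximalRealSubfield L)) L (IsCMField.complexConj L) 1 (JW (↥(maximalRealSubfield L)) L a')).range) μW)
                (Ψ : piSchwartzBruhat (↥(maximalRealSubfield L)) (Fin n'))
                (hθ : MemLp (toQuotFun (adelicGroupData (↥(maximalRealSubfield L)) L (IsCMField.complexConj L) 2 H) fun x =>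
                  (lineThetaKernelDatum L 2 e₁ dV hdV hdV0 lam hlam a' hρ).thetaLiftFun μW Ψ (charCM ξ) (ιA x)) 2 μ),
                v = MemLp.toLp _ hθ} : Set ((adelicGroupData (↥(maximalRealSubfield L)) L (IsCMField.complexConj L) 2 H).L2 μ)))
    (hIrr :
      ∀ (L : Type) [Field L] [NumberField L] [IsCMField L] (ι : L →+* ℂ) (H : Matrix (Fin 2) (Fin 2) L)
          (dV : Fin 2 → L) (hdV : ∀ i, IsCMField.complexConj L (dV i) = dV i) (hdV0 : ∀ i, dV i ≠ 0)
          (t : L) (ht : t ≠ 0) (g : GL (Fin 2) L)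
          (_hg : formCongr ((IsCMField.complexConj L : L ≃ₐ[↥(maximalRealSubfield L)] L) : L →+* L) g (t • H) = Matrix.diagonal dV),
          (∃ T : GL (Fin 2) ℂ, formCongr (starRingEnd ℂ) T ((Matrix.diagonal dV).map ι) = Matrix.diagonal ![(1 : ℂ), -1]) →
          (∀ τ' : L →+* ℂ, InfinitePlace.mk τ' ≠ InfinitePlace.mk ι → ((Matrix.diagonal dV).map τ').PosDef) →
          4 ≤ Module.finrank ℚ L →
          ∀ (μ : Measure (adelicGroupData (↥(maximalRealSubfield L)) L (IsCMField.complexConj L) 2 H).automorphicQuotient)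
            [(adelicGroupData (↥(maximalRealSubfield L)) L (IsCMField.complexConj L) 2 H).IsAutomorphicMeasure μ]
            {n' : ℕ} (e₁ : Fin 2 × Fin 1 ≃ Fin n')
            (lam : Literature.NumberTheory.Automorphic.IdeleClassGroup L →ₜ* Circle) (hlam : IsConjugateSymplectic L lam), HasWeight L lam 1 →
          ∀ (ιA : (adelicGroupData (↥(maximalRealSubfield L)) L (IsCMField.complexConj L) 2 H).Adelic →*
              ↥(UnitaryGroup.adelic (↥(maximalRealSubfield L)) L (IsCMField.complexConj L) 2 (Matrix.diagonal dV))),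
            (∀ k, ((ιA k : ↥(UnitaryGroup.adelic (↥(maximalRealSubfield L)) L (IsCMField.complexConj L) 2 (Matrix.diagonal dV))) :
                  GL (Fin 2) (AdeleRing (𝓞 L) L)) =
                (toAdeleGL L g)⁻¹ * adelicVal (↥(maximalRealSubfield L)) L (IsCMField.complexConj L) 2 H k * toAdeleGL L g) →
          ∀ [CompactSpace (↥(UnitaryGroup.adelic (↥(maximalRealSubfield L)) L (IsCMField.complexConj L) 2 (Matrix.diagonal dV)) ⧸
              (UnitaryGroup.toAdelic (↥(maximalRealSubfield L)) L (IsCMField.complexConj L) 2 (Matrix.diagonal dV)).range)],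
          ∀ (a' : (↥(maximalRealSubfield L))ˣ)
            (ξ : haveI := normal_range_toAdelic_JW L a'
              PontryaginDual (↥(UnitaryGroup.adelic (↥(maximalRealSubfield L)) L (IsCMField.complexConj L) 1 (JW (↥(maximalRealSubfield L)) L a')) ⧸ (UnitaryGroup.toAdelic (↥(maximalRealSubfield L)) L (IsCMField.complexConj L) 1 (JW (↥(maximalRealSubfield L)) L a')).range)),
            ThetaLiftFromLineIrreducible L 2 H e₁ dV hdV hdV0 ιA μ lam hlam a' ξ) :
    ∀ (L : Type) [Field L] [NumberField L] [IsCMField L] (ι : L →+* ℂ) (H : Matrix (Fin 2) (Fin 2) L)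
      (dV : Fin 2 → L) (hdV : ∀ i, IsCMField.complexConj L (dV i) = dV i) (hdV0 : ∀ i, dV i ≠ 0)
      (t : L) (ht : t ≠ 0) (g : GL (Fin 2) L)
      (hg : formCongr ((IsCMField.complexConj L : L ≃ₐ[↥(maximalRealSubfield L)] L) : L →+* L) g (t • H) = Matrix.diagonal dV),
      (∃ T : GL (Fin 2) ℂ, formCongr (starRingEnd ℂ) T ((Matrix.diagonal dV).map ι) = Matrix.diagonal ![(1 : ℂ), -1]) →
      (∀ τ' : L →+* ℂ, InfinitePlace.mk τ' ≠ InfinitePlace.mk ι → ((Matrix.diagonal dV).map τ').PosDef) →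
      4 ≤ Module.finrank ℚ L →
      ∀ (𝔣 : ConeFrame L H (cmPlace L ι))
        (μ : Measure (adelicGroupData (↥(maximalRealSubfield L)) L (IsCMField.complexConj L) 2 H).automorphicQuotient)
        [(adelicGroupData (↥(maximalRealSubfield L)) L (IsCMField.complexConj L) 2 H).IsAutomorphicMeasure μ]
        {n' : ℕ} (e₁ : Fin 2 × Fin 1 ≃ Fin n')
        (lam : Literature.NumberTheory.Automorphic.IdeleClassGroup L →ₜ* Circle) (hlam : IsConjugateSymplectic L lam), HasWeight L lam 1 →
      ∀ (a : (↥(maximalRealSubfield L))ˣ) (χ : Chi (↥(maximalRealSubfield L)) L (IsCMField.complexConj L))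
        (W : Type) [AddCommGroup W] [Module ℂ W]
        (σ : Representation ℂ (finAdelic (↥(maximalRealSubfield L)) L (IsCMField.complexConj L) 2 H) W),
        σ.IsIrreducible → σ.IsSmooth →
      ∀ j : σ.IntertwiningMap
          ((rhoVAtLine (↥(maximalRealSubfield L)) L (IsCMField.complexConj L) 2 e₁ (Matrix.diagonal dV)
              (complexConj_imagUnit L) (imagUnit_ne_zero L) (imagUnit_mul_self L) (realDiagonal_isSymm L dV hdV)
              (isUnit_det_realDiagonal L dV hdV hdV0) (realDiagonal_map L dV hdV).symm
              (fun a => isCompatible_chiSplittingLine L e₁ dV hdV hdV0 (toHeckeCharacter L lam)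
                (isUnitary_toHeckeCharacter L lam) ((isOscillatorChar_toHeckeCharacter_iff lam).mpr hlam)
                (TW (↥(maximalRealSubfield L)) a) (isSymm_TW (↥(maximalRealSubfield L)) a)
                (isUnit_det_TW (↥(maximalRealSubfield L)) a) (JW (↥(maximalRealSubfield L)) L a)
                (JW_eq (↥(maximalRealSubfield L)) L a)) a χ).comp
            (finAdelicCongr (↥(maximalRealSubfield L)) L (IsCMField.complexConj L) g ht hg).symm.toMonoidHom),
        Function.Injective j →
      ∀ [CompactSpace (↥(UnitaryGroup.adelic (↥(maximalRealSubfield L)) L (IsCMField.complexConj L) 2 (Matrix.diagonal dV)) ⧸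
          (UnitaryGroup.toAdelic (↥(maximalRealSubfield L)) L (IsCMField.complexConj L) 2 (Matrix.diagonal dV)).range)],
      ∀ P : DiscreteAutomorphicRep (adelicGroupData (↥(maximalRealSubfield L)) L (IsCMField.complexConj L) 2 H) μ,
        P.IsHolCotangentAt₂ (IsCMField.complexConj_ne_one L) (UnitaryGroup.complexConj_smul_infinitePlace L) (cmPlace L ι) 𝔣 →
        P.HasFinComponent σ →
        ∃ (ιA : (adelicGroupData (↥(maximalRealSubfield L)) L (IsCMField.complexConj L) 2 H).Adelic →*
            ↥(UnitaryGroup.adelic (↥(maximalRealSubfield L)) L (IsCMField.complexConj L) 2 (Matrix.diagonal dV))),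
          (∀ k, ((ιA k : ↥(UnitaryGroup.adelic (↥(maximalRealSubfield L)) L (IsCMField.complexConj L) 2 (Matrix.diagonal dV))) :
                GL (Fin 2) (AdeleRing (𝓞 L) L)) =
              (toAdeleGL L g)⁻¹ * adelicVal (↥(maximalRealSubfield L)) L (IsCMField.complexConj L) 2 H k * toAdeleGL L g) ∧
          ∃ a' : (↥(maximalRealSubfield L))ˣ, MeetsThetaLiftFromLine L 2 H e₁ dV hdV hdV0 P lam hlam a' ιA := by
  intro L _ _ _ ι H dV hdV hdV0 t ht g hg hsig hdef h4 𝔣 μA _ n' e₁ lam hlam hw a χ W _ _ σ hσi hσs j hj _ P hhol hfin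
  -- the pinned transport exists under the scaled frame
  obtain ⟨ιA, hpin⟩ := F0LD2ArchAdmissibleAssembly.exists_adelicFrameTransport_smul L 2 H dV t ht g hg
  -- `[U(H)]` is compact
  haveI : CompactSpace (adelicGroupData (↥(maximalRealSubfield L)) L (IsCMField.complexConj L) 2 H).automorphicQuotient := by
    obtain ⟨τ, hτ⟩ := UnitaryGroup.exists_infinitePlace_ne L h4 ι
    exact UnitaryGroup.compactSpace_adelicGroupData_automorphicQuotient L 2 H
      (UnitaryGroup.anisotropic_of_formCongr_smul_eq_of_posDef L 2 H dV t ht g hg τ (hdef τ hτ))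
  -- the letter: a line `a′` and a theta class with non-zero projection to `P`
  obtain ⟨a', hpr⟩ := hAP L ι H dV hdV hdV0 t ht g hg hsig hdef h4 𝔣 μA e₁ lam hlam hw a χ W σ hσi hσs j hj ιA hpin P hhol hfin
  exact ⟨ιA, hpin, a', F0LD1MeetsOfRealises.meetsThetaLiftFromLine_of_realises L 2 H e₁ dV hdV hdV0 t ht g hg ιA hpin
    P lam hlam a' (hIrr L ι H dV hdV hdV0 t ht g hg hsig hdef h4 μA e₁ lam hlam hw ιA hpin a')
    (hB6 L ι H dV hdV hdV0 t ht g hg hsig hdef h4 μA e₁ lam hlam hw ιA hpin a') hpr⟩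

end Summit.HodgeConjecture.HodgeConjecture.Cruxes.HLiu418.F0LD1ThetaRealisationOfB6

end
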